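import Literature.Combinatorics.StablePolynomials.DiskStabilityPreservers
import HarnessLib

/-!
# The master composition theorem for the unit disk (Borcea–Brändén II, Corollary 3.4 (c))

J. Borcea, P. Brändén, *The Lee–Yang and Pólya–Schur programs. II.*, Comm. Pure Appl. Math. 62 (2009)
1595–1631 (arXiv:0809.3087), §3, Corollary 3.4: let `κ ∈ ℕⁿ` and
`f(z,w) = Σ_{α ≤ κ} binom(κ,α) P_α(w) z^α`, `g(z,w) = Σ_{α ≤ κ} binom(κ,α) Q_α(z) w^α`.

> (c) If `f` and `g` are `𝔻`-stable, then so is the polynomial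
> `Σ_{α ≤ κ} binom(κ,α) P_α(w) Q_α(z) = (1/κ!) Σ_{α≤κ} ((κ-α)!/α!) ∂^α f/∂z^α (0,w) · ∂^α g/∂w^α (z,0)`
> unless it is identically zero.

"Parts (b) and (c) follow similarly" to (a): here the proof of (a) printed in part II is run with Theorem 3.2
for `C = 𝔻` (`BorceaBranden_diskStabilityPreserver_iff`, symbol `T[(1+zw)^κ]`) in place of Theorem 3.1: the
operator `S : z^α ↦ Q_α` (`mvSlotOpD`) has `𝔻`-symbol `g`; the operator `T` of the tree (`mvOpOf`) fed with the
box-reflected coefficients `P_α^♭` (`reverseBox`) has `𝔻`-symbol `f`; both preserve `𝔻`-stability, hence so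
does `ST`, whose `𝔻`-symbol is the polynomial in (c); Theorem 3.2 then gives "(c) or a product `A(z)B(w)`",
and exchanging the roles of `f` and `g` finishes as in the tree's `mv_master_composition`.

## Contents

* `mvCompositionD κ P Q` — `Σ_{α≤κ} binom(κ,α) P_α(w) Q_α(z)`; `rename_swap_mvCompositionD`.
* `reverseBox β` (`z^m ↦ z^{β-m}` on `ℂ_β[z]`), `coeff_reverseBox`, `reverseBox_reverseBox`.
* `mvSlotOpD`, `symbolD_mvSlotOpD`, `symbolD_mvOpOf`, `boundedDegreeSymbolD_of_rankOne`.
* `mv_master_composition_disk_pass`, **`mv_master_composition_disk`** (Cor. 3.4 (c), every `κ ∈ ℕⁿ`).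

## References

* [BorceaBranden2009II] J. Borcea, P. Brändén, Comm. Pure Appl. Math. 62 (2009) 1595–1631, §3 Cor. 3.4 (c).
-/

noncomputable section

open MvPolynomial Finset

namespace Literature.Combinatorics.StablePolynomials

variable {τ : Type*} [Fintype τ] [DecidableEq τ]

/-! ## §1 The polynomial of (c), the box reflection, `𝔻`-stability under renaming -/

section Defs

/-- **`Σ_{α ≤ κ} binom(κ,α) P_α(w) Q_α(z)`** (`z_i = X (inl i)`, `w_i = X (inr i)`).
[cite: BorceaBranden2009II, §3 Cor. 3.4 (c)] -/
def mvCompositionD (κ : τ → ℕ) (P Q : (τ → ℕ) → MvPolynomial τ ℂ) : MvPolynomial (τ ⊕ τ) ℂ :=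
  ∑ α ∈ Fintype.piFinset (fun i => range (κ i + 1)),
    (∏ i, (((κ i).choose (α i) : ℕ) : ℂ)) • (rename Sum.inl (Q α) * rename Sum.inr (P α))

omit [Fintype τ] [DecidableEq τ] in
/-- `z ↔ w` on `ι_z`. [cite: BorceaBranden2009II, §3 proof of Cor. 3.4 ("exchanging the roles of `f` and `g`")] -/
private theorem rename_swap_rename_inl' (q : MvPolynomial τ ℂ) :
    rename Sum.swap (rename Sum.inl q) = (rename Sum.inr q : MvPolynomial (τ ⊕ τ) ℂ) := by
  rw [rename_rename]
  rfl

omit [Fintype τ] [DecidableEq τ] in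
/-- `z ↔ w` on `ι_w`. [cite: BorceaBranden2009II, §3 proof of Cor. 3.4] -/
private theorem rename_swap_rename_inr' (q : MvPolynomial τ ℂ) :
    rename Sum.swap (rename Sum.inr q) = (rename Sum.inl q : MvPolynomial (τ ⊕ τ) ℂ) := by
  rw [rename_rename]
  rfl

/-- Exchanging `z` and `w` exchanges `P` and `Q` in the polynomial of (c). [cite: BorceaBranden2009II, §3 proof
of Cor. 3.4] -/
theorem rename_swap_mvCompositionD (κ : τ → ℕ) (P Q : (τ → ℕ) → MvPolynomial τ ℂ) :
    rename Sum.swap (mvCompositionD κ P Q) = mvCompositionD κ Q P := by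
  rw [mvCompositionD, mvCompositionD, map_sum]
  refine sum_congr rfl fun α _ => ?_
  rw [map_smul, _root_.map_mul, rename_swap_rename_inl', rename_swap_rename_inr', mul_comm]

/-- **The box reflection `z^m ↦ z^{β-m}` of `ℂ_β[z]`** (coefficientwise: `[z^m] p^♭ = [z^{β-m}] p`), used to pass
between the two symbols `T[(z+w)^β]` and `T[(1+zw)^β]`. [cite: BorceaBranden2009II, §3 (after Thm 3.2:
"often more convenient – but equivalent – to choose (3.2) rather than (3.1)")] -/
def reverseBox (β : τ → ℕ) (p : MvPolynomial τ ℂ) : MvPolynomial τ ℂ :=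
  ∑ m ∈ Fintype.piFinset (fun i => range (β i + 1)), coeff (toF (β - m)) p • ∏ i, X i ^ m i

omit [DecidableEq τ] in
/-- `toF` is injective. [cite: BorceaBranden2009II, §1 (multi-index notation)] -/
private theorem toF_injective' {m m' : τ → ℕ} (h : toF m = toF m') : m = m' :=
  funext fun i => by rw [← toF_apply m i, h, toF_apply]

/-- Coefficients of a box sum `Σ_{m ≤ β} c_m z^m`. [cite: BorceaBranden2009II, §1 (the space `ℂ_κ[z]`)] -/
theorem coeff_toF_sum_box (β : τ → ℕ) (c : (τ → ℕ) → ℂ) {m : τ → ℕ}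
    (hm : m ∈ Fintype.piFinset (fun i => range (β i + 1))) :
    coeff (toF m) (∑ m' ∈ Fintype.piFinset (fun i => range (β i + 1)), c m' • ∏ i, (X i : MvPolynomial τ ℂ) ^ m' i) =
      c m := by
  rw [coeff_sum]
  have h : ∀ m' ∈ Fintype.piFinset (fun i => range (β i + 1)),
      coeff (toF m) (c m' • ∏ i, (X i : MvPolynomial τ ℂ) ^ m' i) = if m' = m then c m else 0 := by
    intro m' _
    rw [prod_X_pow_eq_monomial_toF, coeff_smul, coeff_monomial, smul_eq_mul]
    by_cases h' : m' = m
    · rw [if_pos (congrArg toF h'), if_pos h', h', mul_one]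
    · rw [if_neg (fun h2 => h' (toF_injective' h2)), if_neg h', mul_zero]
  rw [sum_congr rfl h, sum_ite_eq', if_pos hm]

/-- **`[z^m] p^♭ = [z^{β-m}] p`** for `m ≤ β`. [cite: BorceaBranden2009II, §3 (symbols (3.1) vs (3.2))] -/
theorem coeff_reverseBox (β : τ → ℕ) (p : MvPolynomial τ ℂ) {m : τ → ℕ}
    (hm : m ∈ Fintype.piFinset (fun i => range (β i + 1))) :
    coeff (toF m) (reverseBox β p) = coeff (toF (β - m)) p :=
  coeff_toF_sum_box β _ hm

/-- A box sum lies in `ℂ_β[z]`. [cite: BorceaBranden2009II, §1 (the space `ℂ_κ[z]`)] -/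
theorem degreeOf_sum_box_le (β : τ → ℕ) (c : (τ → ℕ) → ℂ) (i : τ) :
    degreeOf i (∑ m ∈ Fintype.piFinset (fun i => range (β i + 1)), c m • ∏ j, (X j : MvPolynomial τ ℂ) ^ m j) ≤
      β i := by
  refine (degreeOf_sum_le _ _ _).trans (Finset.sup_le fun m hm => ?_)
  rw [smul_eq_C_mul]
  refine (degreeOf_C_mul_le _ _ _).trans ?_
  rw [degreeOf_prod_X_pow]
  exact mem_box_iff.1 hm i

/-- `p^♭ ∈ ℂ_β[z]`. [cite: BorceaBranden2009II, §3] -/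
theorem degreeOf_reverseBox_le (β : τ → ℕ) (p : MvPolynomial τ ℂ) (i : τ) : degreeOf i (reverseBox β p) ≤ β i :=
  degreeOf_sum_box_le β _ i

/-- **`(p^♭)^♭ = p` on `ℂ_β[z]`.** [cite: BorceaBranden2009II, §3] -/
theorem reverseBox_reverseBox {β : τ → ℕ} {p : MvPolynomial τ ℂ} (hp : ∀ i, degreeOf i p ≤ β i) :
    reverseBox β (reverseBox β p) = p := by
  conv_rhs => rw [eq_sum_box hp]
  rw [reverseBox]
  refine sum_congr rfl fun m hm => ?_
  have hm' := mem_box_iff.1 hm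
  have h1 : β - m ∈ Fintype.piFinset (fun i => range (β i + 1)) := mem_box_iff.2 fun i => Nat.sub_le _ _
  have h2 : β - (β - m) = m := funext fun i => by simp only [Pi.sub_apply, Nat.sub_sub_self (hm' i)]
  rw [coeff_reverseBox β p h1, h2]

/-- `𝔻`-stability is preserved by renaming variables. [cite: BorceaBranden2009II, §1 (definition of
`Ω`-stable)] -/
theorem IsDiskStable.rename {σ σ' : Type*} (f : σ → σ') {p : MvPolynomial σ ℂ} (hp : IsDiskStable p) :
    IsDiskStable (MvPolynomial.rename f p) := fun z hz => by
  rw [eval_rename]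
  exact hp _ fun i => hz (f i)

/-- Products of `𝔻`-stable polynomials are `𝔻`-stable. [cite: BorceaBranden2009II, §1] -/
theorem IsDiskStable.mul {σ : Type*} {p q : MvPolynomial σ ℂ} (hp : IsDiskStable p) (hq : IsDiskStable q) :
    IsDiskStable (p * q) := fun z hz => by
  rw [_root_.map_mul]
  exact mul_ne_zero (hp z hz) (hq z hz)

end Defs

/-! ## §2 Operators with prescribed `𝔻`-symbols -/

section Operators

/-- **The operator `S` with `𝔻`-symbol `g`**: `z^m ↦ Q_m` (`m ≤ κ`), `0` outside the box.
[cite: BorceaBranden2009II, §3 proof of Cor. 3.4 ("the linear operators whose algebraic symbols … are `f`,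
respectively `g`"), part (c)] -/
def mvSlotOpD (κ : τ → ℕ) (Q : (τ → ℕ) → MvPolynomial τ ℂ) : MvPolynomial τ ℂ →ₗ[ℂ] MvPolynomial τ ℂ :=
  (basisMonomials τ ℂ).constr ℂ fun s => if ∀ i, s i ≤ κ i then Q ⇑s else 0

omit [DecidableEq τ] in
/-- `S(z^m) = Q_m` for `m ≤ κ`. [cite: BorceaBranden2009II, §3 proof of Cor. 3.4 (c)] -/
theorem mvSlotOpD_prod_X_pow {κ : τ → ℕ} (Q : (τ → ℕ) → MvPolynomial τ ℂ) {m : τ → ℕ} (hm : ∀ i, m i ≤ κ i) :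
    mvSlotOpD κ Q (∏ i, X i ^ m i) = Q m := by
  rw [prod_X_pow_eq_monomial_toF, show (monomial (toF m) (1 : ℂ)) = basisMonomials τ ℂ (toF m) by
    rw [coe_basisMonomials], mvSlotOpD, Module.Basis.constr_basis,
    if_pos (show ∀ i, (toF m) i ≤ κ i from fun i => hm i)]
  rfl

/-- **The `𝔻`-symbol of `S` on `ℂ_κ[z]` is `g`**: `S[(1+zw)^κ] = Σ binom(κ,α) Q_α(z) w^α`.
[cite: BorceaBranden2009II, §3 proof of Cor. 3.4 (c)] -/
theorem symbolD_mvSlotOpD (κ : τ → ℕ) (Q : (τ → ℕ) → MvPolynomial τ ℂ) :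
    boundedDegreeSymbolD κ (mvSlotOpD κ Q) = mvCompositionG κ Q := by
  rw [boundedDegreeSymbolD, mvCompositionG]
  refine sum_congr rfl fun α hα => ?_
  rw [mvSlotOpD_prod_X_pow Q (mem_box_iff.1 hα)]

/-- **The `𝔻`-symbol of a rank-one operator factorises**: if `L(z^m) = a_m A` for `m ≤ β` then
`L[(1+zw)^β] = A(z)·B(w)` with `B = Σ_m binom(β,m) a_m w^m`. [cite: BorceaBranden2009II, §3 proof of Cor. 3.4
("unless it is of the form `A(z)B(w)`")] -/
theorem boundedDegreeSymbolD_of_rankOne {β : τ → ℕ} {L : MvPolynomial τ ℂ →ₗ[ℂ] MvPolynomial τ ℂ}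
    {a : (τ → ℕ) → ℂ} {A : MvPolynomial τ ℂ}
    (h : ∀ m ∈ Fintype.piFinset (fun i => range (β i + 1)), L (∏ i, X i ^ m i) = a m • A) :
    boundedDegreeSymbolD β L = rename Sum.inl A *
      rename Sum.inr (∑ m ∈ Fintype.piFinset (fun i => range (β i + 1)),
        ((∏ i, (((β i).choose (m i) : ℕ) : ℂ)) * a m) • ∏ i, (X i : MvPolynomial τ ℂ) ^ m i) := by
  rw [map_sum, boundedDegreeSymbolD, mul_sum]
  refine sum_congr rfl fun m hm => ?_
  rw [h m hm, map_smul, map_smul, _root_.map_prod, smul_mul_assoc, smul_smul, mul_smul_comm]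
  simp only [map_pow, rename_X]

/-- **The `𝔻`-symbol of the tree's `mvOpOf`**: `mvOpOf(P,R)[(1+zw)^β] = Σ_{α≤κ} binom(κ,α) R_α(z) P_α^♭(w)`
(the `(z+w)^β`-symbol has `P_α` in place of `P_α^♭`, `symbol_mvOpOf`). [cite: BorceaBranden2009II, §3 proof of
Cor. 3.4 (c)] -/
theorem symbolD_mvOpOf {β κ : τ → ℕ} (P R : (τ → ℕ) → MvPolynomial τ ℂ) :
    boundedDegreeSymbolD β (mvOpOf β κ P R) =
      ∑ α ∈ Fintype.piFinset (fun i => range (κ i + 1)),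
        (∏ i, (((κ i).choose (α i) : ℕ) : ℂ)) • (rename Sum.inl (R α) * rename Sum.inr (reverseBox β (P α))) := by
  have h1 : ∀ m ∈ Fintype.piFinset (fun i => range (β i + 1)),
      (∏ i, (((β i).choose (m i) : ℕ) : ℂ)) •
        (rename Sum.inl (mvOpOf β κ P R (∏ i, X i ^ m i)) * ∏ i, (X (Sum.inr i) : MvPolynomial (τ ⊕ τ) ℂ) ^ m i) =
      ∑ α ∈ Fintype.piFinset (fun i => range (κ i + 1)),
        ((∏ i, (((κ i).choose (α i) : ℕ) : ℂ)) * coeff (toF (β - m)) (P α)) •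
          (rename Sum.inl (R α) * ∏ i, (X (Sum.inr i) : MvPolynomial (τ ⊕ τ) ℂ) ^ m i) := by
    intro m hm
    have hm' := mem_box_iff.1 hm
    have hne : (∏ i, (((β i).choose (m i) : ℕ) : ℂ)) ≠ 0 :=
      prod_ne_zero_iff.2 fun i _ => Nat.cast_ne_zero.2 (Nat.choose_pos (hm' i)).ne'
    rw [mvOpOf_prod_X_pow hm', map_smul, map_sum, smul_mul_assoc, smul_smul, mul_inv_cancel₀ hne, one_smul,
      sum_mul]
    refine sum_congr rfl fun α _ => ?_
    rw [map_smul, smul_mul_assoc]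
  rw [boundedDegreeSymbolD, sum_congr rfl h1, sum_comm]
  refine sum_congr rfl fun α _ => ?_
  rw [reverseBox, map_sum, mul_sum, smul_sum]
  refine sum_congr rfl fun m _ => ?_
  rw [map_smul, _root_.map_prod, mul_smul_comm, smul_smul]
  simp only [map_pow, rename_X]

end Operators

/-! ## §3 Corollary 3.4 (c) -/

section Main

omit [Fintype τ] [DecidableEq τ] in
/-- Substituting constants: `p(C c, …, C c) = C(p(c,…,c))`. [folklore] -/
private theorem aeval_const_C_disk (c : ℂ) (p : MvPolynomial τ ℂ) :
    aeval (fun _ : τ => (C c : MvPolynomial τ ℂ)) p = C (eval (fun _ => c) p) := by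
  induction p using MvPolynomial.induction_on with
  | C a => rw [aeval_C, eval_C, algebraMap_eq]
  | add p q hp hq => rw [map_add, map_add, hp, hq, map_add]
  | mul_X p i hp => rw [_root_.map_mul, aeval_X, hp, _root_.map_mul, eval_X, _root_.map_mul]

/-- **One pass of the printed argument for `𝔻`**: if `f` and `g` are `𝔻`-stable then the polynomial of (c) is
`𝔻`-stable, or it is `A(z)B(w)` with `A` `𝔻`-stable (the rank-one alternative of Theorem 3.2 for `ST`).
[cite: BorceaBranden2009II, §3 proof of Cor. 3.4 ("Parts (b) and (c) follow similarly"), Thm 3.2 (`C = 𝔻`)] -/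
theorem mv_master_composition_disk_pass {κ : τ → ℕ} (P Q : (τ → ℕ) → MvPolynomial τ ℂ)
    (hf : IsDiskStable (mvCompositionF κ P)) (hg : IsDiskStable (mvCompositionG κ Q)) :
    IsDiskStable (mvCompositionD κ P Q) ∨
      ∃ A B : MvPolynomial τ ℂ, IsDiskStable A ∧ mvCompositionD κ P Q = rename Sum.inl A * rename Sum.inr B := by
  -- a common degree box `β` for the `P_α`
  set β : τ → ℕ := fun i => (Fintype.piFinset fun j => range (κ j + 1)).sup fun α => degreeOf i (P α) with hβ
  have hP : ∀ α ∈ Fintype.piFinset (fun j => range (κ j + 1)), ∀ i, degreeOf i (P α) ≤ β i := fun α hα i =>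
    Finset.le_sup (f := fun α => degreeOf i (P α)) hα
  have hPr : ∀ α ∈ Fintype.piFinset (fun j => range (κ j + 1)), ∀ i, degreeOf i (reverseBox β (P α)) ≤ β i :=
    fun α _ i => degreeOf_reverseBox_le β (P α) i
  -- `S` preserves `𝔻`-stability on `ℂ_κ[z]` (its `𝔻`-symbol is `g`)
  have hS : ∀ p : MvPolynomial τ ℂ, (∀ i, degreeOf i p ≤ κ i) → IsDiskStable p →
      IsDiskStable (mvSlotOpD κ Q p) ∨ mvSlotOpD κ Q p = 0 :=
    (BorceaBranden_diskStabilityPreserver_iff κ (mvSlotOpD κ Q)).2 (Or.inr (by rw [symbolD_mvSlotOpD]; exact hg))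
  -- `T` preserves `𝔻`-stability on `ℂ_β[z]` (its `𝔻`-symbol is `f`) and maps into `ℂ_κ[z]`
  set T := mvOpOf β κ (fun α => reverseBox β (P α)) fun α => ∏ i, X i ^ α i with hT
  have hTsymb : boundedDegreeSymbolD β T = mvCompositionF κ P := by
    rw [hT, symbolD_mvOpOf, mvCompositionF]
    refine sum_congr rfl fun α hα => ?_
    rw [reverseBox_reverseBox (hP α hα), _root_.map_prod]
    simp only [_root_.map_pow, rename_X]
  have hTpres : ∀ p : MvPolynomial τ ℂ, (∀ i, degreeOf i p ≤ β i) → IsDiskStable p →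
      IsDiskStable (T p) ∨ T p = 0 :=
    (BorceaBranden_diskStabilityPreserver_iff β T).2 (Or.inr (by rw [hTsymb]; exact hf))
  have hTdeg : ∀ p : MvPolynomial τ ℂ, ∀ i, degreeOf i (T p) ≤ κ i := fun p i =>
    degreeOf_mvOpOf_le (fun α hα j => by rw [degreeOf_prod_X_pow]; exact mem_box_iff.1 hα j) p i
  -- `ST` preserves `𝔻`-stability on `ℂ_β[z]`
  have hST : ∀ p : MvPolynomial τ ℂ, (∀ i, degreeOf i p ≤ β i) → IsDiskStable p →
      IsDiskStable ((mvSlotOpD κ Q ∘ₗ T) p) ∨ (mvSlotOpD κ Q ∘ₗ T) p = 0 := by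
    intro p hp hs
    rw [LinearMap.comp_apply]
    rcases hTpres p hp hs with h | h
    · exact hS _ (hTdeg p) h
    · exact Or.inr (by rw [h, map_zero])
  -- the `𝔻`-symbol of `ST` is the polynomial of (c)
  have hSTsymb : boundedDegreeSymbolD β (mvSlotOpD κ Q ∘ₗ T) = mvCompositionD κ P Q := by
    rw [hT, comp_mvOpOf, symbolD_mvOpOf, mvCompositionD]
    refine sum_congr rfl fun α hα => ?_
    rw [mvSlotOpD_prod_X_pow Q (mem_box_iff.1 hα), reverseBox_reverseBox (hP α hα)]
  -- Theorem 3.2 (`C = 𝔻`) for `ST`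
  rcases (BorceaBranden_diskStabilityPreserver_iff β (mvSlotOpD κ Q ∘ₗ T)).1 hST with ⟨a, A, hA, haA⟩ | hG
  · right
    refine ⟨A, ∑ m ∈ Fintype.piFinset (fun i => range (β i + 1)),
      ((∏ i, (((β i).choose (m i) : ℕ) : ℂ)) * a (∏ i, X i ^ m i)) • ∏ i, (X i : MvPolynomial τ ℂ) ^ m i,
      hA, ?_⟩
    rw [← hSTsymb]
    exact boundedDegreeSymbolD_of_rankOne fun m hm =>
      haA _ fun i => by rw [degreeOf_prod_X_pow]; exact mem_box_iff.1 hm i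
  · left
    rwa [hSTsymb] at hG

/-- **Borcea–Brändén II, Corollary 3.4 (c), every number of variables and every `κ ∈ ℕⁿ`.** If
`f(z,w) = Σ_{α≤κ} binom(κ,α) P_α(w) z^α` and `g(z,w) = Σ_{α≤κ} binom(κ,α) Q_α(z) w^α` are `𝔻`-stable, then
`Σ_{α≤κ} binom(κ,α) P_α(w) Q_α(z)` is `𝔻`-stable or identically zero. [cite: BorceaBranden2009II, §3 Cor. 3.4
(c) and the proof of Cor. 3.4] -/
theorem mv_master_composition_disk {κ : τ → ℕ} (P Q : (τ → ℕ) → MvPolynomial τ ℂ)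
    (hf : IsDiskStable (mvCompositionF κ P)) (hg : IsDiskStable (mvCompositionG κ Q)) :
    mvCompositionD κ P Q = 0 ∨ IsDiskStable (mvCompositionD κ P Q) := by
  -- the data with `z ↔ w`, `f ↔ g`
  have hf' : IsDiskStable (mvCompositionF κ Q) := by
    rw [← rename_swap_mvCompositionG]
    exact hg.rename Sum.swap
  have hg' : IsDiskStable (mvCompositionG κ P) := by
    rw [← rename_swap_mvCompositionF]
    exact hf.rename Sum.swap
  rcases mv_master_composition_disk_pass P Q hf hg with h1 | ⟨A, B, hA, hAB⟩
  · exact Or.inr h1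
  rcases mv_master_composition_disk_pass Q P hf' hg' with h2 | ⟨A', B', hA', hAB'⟩
  · refine Or.inr ?_
    rw [← rename_swap_mvCompositionD] at h2
    have h3 := h2.rename Sum.swap
    rwa [rename_rename, Sum.swap_swap_eq, rename_id] at h3
  -- both passes give product forms: `A(z)B(w) = B'(z)A'(w)`
  have hprod : rename Sum.inl A * rename Sum.inr B =
      (rename Sum.inl B' * rename Sum.inr A' : MvPolynomial (τ ⊕ τ) ℂ) := by
    rw [← hAB, ← rename_swap_mvCompositionD κ Q P, hAB', _root_.map_mul, rename_swap_rename_inl',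
      rename_swap_rename_inr', mul_comm]
  by_cases hB : B = 0
  · left
    rw [hAB, hB, map_zero, mul_zero]
  · right
    -- specialise `z = 0 ∈ 𝔻ⁿ`: `A(0) B = B'(0) A'`
    have hA0 : eval (fun _ : τ => (0 : ℂ)) A ≠ 0 := hA _ fun _ => by simp
    have hspec : C (eval (fun _ : τ => (0 : ℂ)) A) * B = C (eval (fun _ : τ => (0 : ℂ)) B') * A' := by
      have h := congrArg (MvPolynomial.aeval (Sum.elim (fun _ : τ => (C 0 : MvPolynomial τ ℂ)) X)) hprod
      simp only [_root_.map_mul, aeval_rename, Sum.elim_comp_inl, Sum.elim_comp_inr, aeval_X_left_apply] at h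
      rwa [aeval_const_C_disk, aeval_const_C_disk] at h
    have hB'0 : eval (fun _ : τ => (0 : ℂ)) B' ≠ 0 := by
      intro h0
      rw [h0, map_zero, zero_mul, mul_eq_zero] at hspec
      rcases hspec with h | h
      · exact hA0 (C_eq_zero.1 h)
      · exact hB h
    have hBeq : B = C (eval (fun _ : τ => (0 : ℂ)) B' / eval (fun _ : τ => (0 : ℂ)) A) * A' := by
      rw [div_eq_mul_inv, mul_comm (eval _ B'), C_mul, mul_assoc, ← hspec, ← mul_assoc, ← C_mul,
        inv_mul_cancel₀ hA0, C_1, one_mul]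
    have hBs : IsDiskStable B := fun w hw => by
      rw [hBeq, _root_.map_mul, eval_C]
      exact mul_ne_zero (div_ne_zero hB'0 hA0) (hA' w hw)
    rw [hAB]
    exact (hA.rename Sum.inl).mul (hBs.rename Sum.inr)

end Main

end Literature.Combinatorics.StablePolynomials

end
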